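import Summits.QuantumFields.YangMills.Theorems.FluctuationComparisonRegPrIntLOddsLedgerVers
import HarnessLib

/-!
# `FluctuationComparisonRegPrIntLOddsLedgerReduction` — LINE g20-2 «ODDS LEDGER FOR LFR♯ᶜ», IMPORTABLE: LFR♯ᶜ ⟸ PREG ∧ LEV (VERS discharged by ✓`…OddsLedgerVers`)
# (crux `UnitScaleTilt.FluctuationComparisonRegPrIntL`, stmt-QuantumFields-20520; organ LFR♯ᶜ `LargeFieldFourPtCan`; line file `Cruxes/…/Lines/odds_ledger.lean` v1.2)

Cell `ym3-torus` (YM ladder rung R3 = continuum SU(2) Yang–Mills on T³ — a RUNG, NOT the Clay problem: not d = 4, not infinite volume, not a mass gap);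
width seat `ym3-torus-px19` (gen 11); helper `--supports stmt-QuantumFields-20520`.  THEOREMS ONLY (0 `def`, 0 `sorry`, default heartbeats).

WHY (★★OWNER RULING №36 (4) ∕ №37 (2)(3): the consolidating 20520 registration lists the lane's ACTUAL open rows; a by-name row must live in an IMPORTABLE module or
carry its full text).  LINE g20-2 proves LFR♯ᶜ ⟸ VERS ∧ PREG ∧ LEV inside its Cruxes file; VERS is ✓p752318.  This file RE-TYPES the line's §2∕§4 (the telescope and
`largeFieldFourPtCan_of_ledger`) over importable letters — `partialDensityCan M` UNFOLDED to `heightDensityCan` of the depth-filtered event `histGoodBelow M` written as a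
set-builder, `oddsInc`∕`fourPt` unfolded — so that the skeleton of record can carry PREG and LEV (full texts) as rows and close LFR♯ᶜ BY NAME:
`theorem stub_largeFieldFourPtCan : LargeFieldFourPtCan := largeFieldFourPtCan_of_partialWindowPositivity_of_levelOddsLedger stub_partialWindowPositivityCan stub_levelOddsLedgerCan`.
* §1 the two ends of the filtration as set identities (`histGoodBelow 0 = univ`, `histGoodBelow (K−J+1) = histGood`) and ★`log_sub_log_eq_ledger` (the telescope,
  `Finset.sum_range_sub'`);
* §2 ★★★`largeFieldFourPtCan_of_partialWindowPositivity_of_levelOddsLedger : ⟨PREG `PartialWindowPositivityCan`, unfolded⟩ → ⟨LEV `LevelOddsLedgerCan`, unfolded⟩ →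
  ⟨LFR♯ᶜ `LargeFieldFourPtCan`, `fourPt` unfolded⟩` (VERS := ✓`fullVersionConstCan` inside; thresholds `max pS`∕`min γ₁`; triangle inequality over the scales, reflected
  budget index, uniform partial sums — the line's proof verbatim).
* §3 (v1.1) ★★★`largeFieldFourPtCan_of_partialWindowPositivity'_of_levelOddsLedger` — the same with PREG′ (positivity asked inside LFR♯ᶜ's `(ν, ρ)`-context; px16 g12's
  `…PregEnds` shape), so that LFR♯ᶜ ⟸ PWREG-int ∧ LEV by name once `…PregEnds` lands.
HONEST SCOPE.  A port of the ideator's kernel-checked Cruxes composition (ym-r3-idea-1 g20) to an importable module; proves nothing new: PREG (WREG-class for the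
depth-filtered events), LEV (the XL organ), LFR♯ᶜ, S2β, `FluctuationComparisonRegPrIntL` 20520, `YM3TorusSU2` are NOT proved; no summit statement is proved; the
Yang–Mills mass gap is NOT proved.
References: [Balaban1985UV3] (7) p. 257 and (38)–(47) pp. 266–267 (the small∕large-field decomposition one scale at a time).
-/

noncomputable section

set_option autoImplicit false

open MeasureTheory Filter Topology Set
open scoped BigOperators
open Literature.MathematicalPhysics.QuantumFieldTheory.Balaban1983to89
open Literature.MathematicalPhysics.QuantumFieldTheory.Balaban1983to89.T3ContinuumYM3Torus
open Literature.MathematicalPhysics.QuantumFieldTheory.Balaban1983to89.T3NestedUnitLaws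
open Literature.MathematicalPhysics.QuantumFieldTheory.Balaban1983to89.T3UnitLawDensityEML
open Literature.MathematicalPhysics.QuantumFieldTheory.Balaban1983to89.T3UnitScaleTilt
open Summit.QuantumFields.YangMills.Theorems.FluctuationComparisonRegPrIntLWregGlue (heightDensityCan)
open Summit.QuantumFields.YangMills.Theorems.FluctuationComparisonRegPrIntLOddsLedgerVers (fullVersionConstCan)

namespace Summit.QuantumFields.YangMills.Theorems.FluctuationComparisonRegPrIntLOddsLedgerReduction

/-! ## §1 The two ends of the depth filtration and the telescope -/

/-- No depth constrained: the filtered event is everything. [cite: Balaban1985UV3, (7) p.257] -/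
theorem histGoodBelow_zero_eq_univ (F : T3Family) (θ : ℕ → ℝ) (K n : ℕ) :
    {Y : GaugeField (F.P K) 0 (Matrix.specialUnitaryGroup (Fin 2) ℂ) | ∀ j, j + n ≤ K → j < 0 → PlaqSmall (θ (K - j))
      (Averaging.iter (fun i => BlockAveraging.blockAvg (P := F.P K) (j := i) ℰp) j Y)} = Set.univ := by
  ext Y
  simp

/-- All constrained depths filtered: the event is Bałaban's `histGood`. [cite: Balaban1985UV3, (7) p.257] -/
theorem histGoodBelow_top_eq_histGood (F : T3Family) (θ : ℕ → ℝ) {K n M : ℕ} (h : K - n < M) :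
    {Y : GaugeField (F.P K) 0 (Matrix.specialUnitaryGroup (Fin 2) ℂ) | ∀ j, j + n ≤ K → j < M → PlaqSmall (θ (K - j))
      (Averaging.iter (fun i => BlockAveraging.blockAvg (P := F.P K) (j := i) ℰp) j Y)} = histGood F ℰp θ K n := by
  ext Y
  simp only [histGood, Set.mem_setOf_eq]
  constructor
  · intro hY j hj
    exact hY j hj (by omega)
  · intro hY j hj _
    exact hY j hj

/-- ★ **THE LEDGER IDENTITY** (the line's `log_sub_log_eq_ledger`, unfolded): LFR♯ᶜ's function = the version term + the telescoping sum of the per-scale odds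
increments up to the height-`J` scale. [folklore] -/
theorem log_sub_log_eq_ledger (F : T3Family) (γ b₀ p₀ : ℝ) {J K : ℕ} (hJK : J ≤ K) (ρ : GaugeField (F.P J) 0 (Matrix.specialUnitaryGroup (Fin 2) ℂ) → ℝ) (U : GaugeField (F.P J) 0 (Matrix.specialUnitaryGroup (Fin 2) ℂ)) :
    Real.log (ρ U) - Real.log (heightDensityCan F γ hJK (histGood F ℰp (θBal F.L γ b₀ p₀) K J) U) =
      (Real.log (ρ U) - Real.log (heightDensityCan F γ hJK Set.univ U)) +
        ∑ M ∈ Finset.range (K - J + 1),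
          (Real.log (heightDensityCan F γ hJK
                {Y : GaugeField (F.P K) 0 (Matrix.specialUnitaryGroup (Fin 2) ℂ) | ∀ j, j + J ≤ K → j < M → PlaqSmall (θBal F.L γ b₀ p₀ (K - j))
                  (Averaging.iter (fun i => BlockAveraging.blockAvg (P := F.P K) (j := i) ℰp) j Y)} U)
              - Real.log (heightDensityCan F γ hJK
                {Y : GaugeField (F.P K) 0 (Matrix.specialUnitaryGroup (Fin 2) ℂ) | ∀ j, j + J ≤ K → j < (M + 1) → PlaqSmall (θBal F.L γ b₀ p₀ (K - j))
                  (Averaging.iter (fun i => BlockAveraging.blockAvg (P := F.P K) (j := i) ℰp) j Y)} U)) := by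
  rw [Finset.sum_range_sub' (fun M => Real.log (heightDensityCan F γ hJK
                {Y : GaugeField (F.P K) 0 (Matrix.specialUnitaryGroup (Fin 2) ℂ) | ∀ j, j + J ≤ K → j < M → PlaqSmall (θBal F.L γ b₀ p₀ (K - j))
                  (Averaging.iter (fun i => BlockAveraging.blockAvg (P := F.P K) (j := i) ℰp) j Y)} U)) (K - J + 1)]
  rw [histGoodBelow_zero_eq_univ F (θBal F.L γ b₀ p₀) K J, histGoodBelow_top_eq_histGood F (θBal F.L γ b₀ p₀) (Nat.lt_succ_self (K - J))]
  ring

/-! ## §2 LFR♯ᶜ ⟸ PREG ∧ LEV (VERS inside) — the line's texts unfolded over importable letters -/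

/-- ★★★ **LFR♯ᶜ ⟸ PREG ∧ LEV** (LINE g20-2's `largeFieldFourPtCan_of_ledger` with VERS := ✓`fullVersionConstCan`): hypotheses = PREG `PartialWindowPositivityCan` and
LEV `LevelOddsLedgerCan`, conclusion = LFR♯ᶜ `LargeFieldFourPtCan`, all VERBATIM with `partialDensityCan`∕`histGoodBelow`∕`oddsInc`∕`fourPt` unfolded
(`heightDensityCan` = ✓WregGlue's), so the line closes `stub_largeFieldFourPtCan` by `delta`.  Telescope, `fourPt`-additivity, VERS kills the version term,
triangle inequality over the scales, reflected budget index, uniform partial-sum bound. [cite: Balaban1985UV3, (38)-(47) p.266-267] -/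
theorem largeFieldFourPtCan_of_partialWindowPositivity_of_levelOddsLedger
    (hP :
    ∀ (L : ℕ), ∃ pS : ℝ, ∀ (b₀ p₀ : ℝ), 0 < b₀ → pS ≤ p₀ → 0 < p₀ →
      ∃ γ₁ : ℝ, 0 < γ₁ ∧ ∀ (F : T3Family) (γ : ℝ), F.L = L → 0 < γ → γ ≤ γ₁ →
        ∀ (J K : ℕ) (hJK : J ≤ K),
          (∀ U : GaugeField (F.P J) 0 (Matrix.specialUnitaryGroup (Fin 2) ℂ), PlaqSmall (θBal F.L γ b₀ p₀ J) U →
              0 < heightDensityCan F γ hJK (histGood F ℰp (θBal F.L γ b₀ p₀) K J) U) →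
          ∀ (M : ℕ) (U : GaugeField (F.P J) 0 (Matrix.specialUnitaryGroup (Fin 2) ℂ)), PlaqSmall (θBal F.L γ b₀ p₀ J) U →
            0 < heightDensityCan F γ hJK
                {Y : GaugeField (F.P K) 0 (Matrix.specialUnitaryGroup (Fin 2) ℂ) | ∀ j, j + J ≤ K → j < M → PlaqSmall (θBal F.L γ b₀ p₀ (K - j))
                  (Averaging.iter (fun i => BlockAveraging.blockAvg (P := F.P K) (j := i) ℰp) j Y)} U)
    (hL :
    ∀ (L : ℕ), ∃ pS : ℝ, ∀ (b₀ p₀ : ℝ), 0 < b₀ → pS ≤ p₀ → 0 < p₀ →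
      ∃ γ₁ : ℝ, 0 < γ₁ ∧ ∃ κ : ℝ, 0 < κ ∧ ∀ (F : T3Family) (γ : ℝ), F.L = L → 0 < γ → γ ≤ γ₁ →
        ∃ w : ℕ → ℕ → ℝ, (∀ J r, 0 ≤ w J r) ∧
          ∃ ψ : ℕ → ℝ, (∀ J, 0 ≤ ψ J) ∧ Tendsto (fun J : ℕ => (J : ℝ) * ψ J) atTop (𝓝 0) ∧
            (∀ J R, ∑ r ∈ Finset.range R, w J r ≤ ψ J) ∧
            ∀ (J K : ℕ) (hJK : J ≤ K),
              (∀ (M : ℕ) (U : GaugeField (F.P J) 0 (Matrix.specialUnitaryGroup (Fin 2) ℂ)), PlaqSmall (θBal F.L γ b₀ p₀ J) U →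
                  0 < heightDensityCan F γ hJK
                {Y : GaugeField (F.P K) 0 (Matrix.specialUnitaryGroup (Fin 2) ℂ) | ∀ j, j + J ≤ K → j < M → PlaqSmall (θBal F.L γ b₀ p₀ (K - j))
                  (Averaging.iter (fun i => BlockAveraging.blockAvg (P := F.P K) (j := i) ℰp) j Y)} U) →
              ∀ (M : ℕ), M + J ≤ K →
              ∀ (b b' : PBond (F.P J) 0) (U V W Z : GaugeField (F.P J) 0 (Matrix.specialUnitaryGroup (Fin 2) ℂ)),
                PlaqSmall (θBal F.L γ b₀ p₀ J) U → PlaqSmall (θBal F.L γ b₀ p₀ J) V →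
                PlaqSmall (θBal F.L γ b₀ p₀ J) W → PlaqSmall (θBal F.L γ b₀ p₀ J) Z →
                (∀ e, e ≠ b → U e = V e) → (∀ e, e ≠ b' → U e = W e) → (∀ e, e ≠ b' → V e = Z e) → (∀ e, e ≠ b → W e = Z e) →
                |(((Real.log (heightDensityCan F γ hJK
                {Y : GaugeField (F.P K) 0 (Matrix.specialUnitaryGroup (Fin 2) ℂ) | ∀ j, j + J ≤ K → j < M → PlaqSmall (θBal F.L γ b₀ p₀ (K - j))
                  (Averaging.iter (fun i => BlockAveraging.blockAvg (P := F.P K) (j := i) ℰp) j Y)} U)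
              - Real.log (heightDensityCan F γ hJK
                {Y : GaugeField (F.P K) 0 (Matrix.specialUnitaryGroup (Fin 2) ℂ) | ∀ j, j + J ≤ K → j < (M + 1) → PlaqSmall (θBal F.L γ b₀ p₀ (K - j))
                  (Averaging.iter (fun i => BlockAveraging.blockAvg (P := F.P K) (j := i) ℰp) j Y)} U)) - (Real.log (heightDensityCan F γ hJK
                {Y : GaugeField (F.P K) 0 (Matrix.specialUnitaryGroup (Fin 2) ℂ) | ∀ j, j + J ≤ K → j < M → PlaqSmall (θBal F.L γ b₀ p₀ (K - j))
                  (Averaging.iter (fun i => BlockAveraging.blockAvg (P := F.P K) (j := i) ℰp) j Y)} V)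
              - Real.log (heightDensityCan F γ hJK
                {Y : GaugeField (F.P K) 0 (Matrix.specialUnitaryGroup (Fin 2) ℂ) | ∀ j, j + J ≤ K → j < (M + 1) → PlaqSmall (θBal F.L γ b₀ p₀ (K - j))
                  (Averaging.iter (fun i => BlockAveraging.blockAvg (P := F.P K) (j := i) ℰp) j Y)} V)))
            - ((Real.log (heightDensityCan F γ hJK
                {Y : GaugeField (F.P K) 0 (Matrix.specialUnitaryGroup (Fin 2) ℂ) | ∀ j, j + J ≤ K → j < M → PlaqSmall (θBal F.L γ b₀ p₀ (K - j))
                  (Averaging.iter (fun i => BlockAveraging.blockAvg (P := F.P K) (j := i) ℰp) j Y)} W)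
              - Real.log (heightDensityCan F γ hJK
                {Y : GaugeField (F.P K) 0 (Matrix.specialUnitaryGroup (Fin 2) ℂ) | ∀ j, j + J ≤ K → j < (M + 1) → PlaqSmall (θBal F.L γ b₀ p₀ (K - j))
                  (Averaging.iter (fun i => BlockAveraging.blockAvg (P := F.P K) (j := i) ℰp) j Y)} W)) - (Real.log (heightDensityCan F γ hJK
                {Y : GaugeField (F.P K) 0 (Matrix.specialUnitaryGroup (Fin 2) ℂ) | ∀ j, j + J ≤ K → j < M → PlaqSmall (θBal F.L γ b₀ p₀ (K - j))
                  (Averaging.iter (fun i => BlockAveraging.blockAvg (P := F.P K) (j := i) ℰp) j Y)} Z)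
              - Real.log (heightDensityCan F γ hJK
                {Y : GaugeField (F.P K) 0 (Matrix.specialUnitaryGroup (Fin 2) ℂ) | ∀ j, j + J ≤ K → j < (M + 1) → PlaqSmall (θBal F.L γ b₀ p₀ (K - j))
                  (Averaging.iter (fun i => BlockAveraging.blockAvg (P := F.P K) (j := i) ℰp) j Y)} Z))))| ≤ w J (K - J - M) * Real.exp (-(κ * (b.src.tdist b'.src : ℝ)))) :
    ∀ (L : ℕ), ∃ pS : ℝ, ∀ (b₀ p₀ : ℝ), 0 < b₀ → pS ≤ p₀ → 0 < p₀ →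
      ∃ γ₁ : ℝ, 0 < γ₁ ∧ ∃ κ : ℝ, 0 < κ ∧ ∀ (F : T3Family) (γ : ℝ), F.L = L → 0 < γ → γ ≤ γ₁ →
        ∃ ψ : ℕ → ℝ, (∀ J, 0 ≤ ψ J) ∧ Tendsto (fun J : ℕ => (J : ℝ) * ψ J) atTop (𝓝 0) ∧
          ∀ (ν : ℕ → (j : ℕ) → Measure (GaugeField (F.P j) 0 (Matrix.specialUnitaryGroup (Fin 2) ℂ))),
            (∀ K, ν K K = T4GenFunBounds.gibbsMeasure (F.P K) ((F.scheme ℰp γ).β K)) →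
            (∀ K j, j < K → ν K j = Measure.map (descend F ℰp j) (ν K (j + 1))) →
            ∀ (J K : ℕ) (hJK : J ≤ K) (ρ : GaugeField (F.P J) 0 (Matrix.specialUnitaryGroup (Fin 2) ℂ) → ℝ),
              (∀ U, PlaqSmall (θBal F.L γ b₀ p₀ J) U → 0 < ρ U) →
              ν K J = (fieldMeasure _ _ _).withDensity (fun U => ENNReal.ofReal (ρ U)) →
              ContinuousOn ρ {U | PlaqSmall (θBal F.L γ b₀ p₀ J) U} →
              (∀ U : GaugeField (F.P J) 0 (Matrix.specialUnitaryGroup (Fin 2) ℂ), PlaqSmall (θBal F.L γ b₀ p₀ J) U →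
                  0 < heightDensityCan F γ hJK (histGood F ℰp (θBal F.L γ b₀ p₀) K J) U) →
              ∀ (b b' : PBond (F.P J) 0) (U V W Z : GaugeField (F.P J) 0 (Matrix.specialUnitaryGroup (Fin 2) ℂ)),
                PlaqSmall (θBal F.L γ b₀ p₀ J) U → PlaqSmall (θBal F.L γ b₀ p₀ J) V →
                PlaqSmall (θBal F.L γ b₀ p₀ J) W → PlaqSmall (θBal F.L γ b₀ p₀ J) Z →
                (∀ e, e ≠ b → U e = V e) → (∀ e, e ≠ b' → U e = W e) → (∀ e, e ≠ b' → V e = Z e) → (∀ e, e ≠ b → W e = Z e) →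
                |(((Real.log (ρ U) - Real.log (heightDensityCan F γ hJK (histGood F ℰp (θBal F.L γ b₀ p₀) K J) U)) - (Real.log (ρ V) - Real.log (heightDensityCan F γ hJK (histGood F ℰp (θBal F.L γ b₀ p₀) K J) V)))
            - ((Real.log (ρ W) - Real.log (heightDensityCan F γ hJK (histGood F ℰp (θBal F.L γ b₀ p₀) K J) W)) - (Real.log (ρ Z) - Real.log (heightDensityCan F γ hJK (histGood F ℰp (θBal F.L γ b₀ p₀) K J) Z))))|
                  ≤ ψ J * Real.exp (-(κ * (b.src.tdist b'.src : ℝ))) := by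
  intro L
  obtain ⟨pP, hP⟩ := hP L
  obtain ⟨pL, hL⟩ := hL L
  refine ⟨max pP pL, fun b₀ p₀ hb₀ hp hp₀ => ?_⟩
  obtain ⟨γP, hγP, hP⟩ := hP b₀ p₀ hb₀ ((le_max_left _ _).trans hp) hp₀
  obtain ⟨γL, hγL, κ, hκ, hL⟩ := hL b₀ p₀ hb₀ ((le_max_right _ _).trans hp) hp₀
  refine ⟨min γP γL, lt_min hγP hγL, κ, hκ, fun F γ hFL hγ hγ₁ => ?_⟩
  obtain ⟨w, hw0, ψ, hψ0, hψt, hwψ, hL⟩ := hL F γ hFL hγ (hγ₁.trans (min_le_right _ _))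
  have hP' := hP F γ hFL hγ (hγ₁.trans (min_le_left _ _))
  refine ⟨ψ, hψ0, hψt, ?_⟩
  intro ν hνK hνd J K hJK ρ hρ hνρ hρc hpos b b' U V W Z hU hV' hW hZ h1 h2 h3 h4
  obtain ⟨c, hc⟩ := fullVersionConstCan F γ b₀ p₀ hγ ν hνK hνd J K hJK ρ hρ hνρ hρc
  have hposM := hP' J K hJK hpos
  -- the ledger identity at the four corners
  rw [log_sub_log_eq_ledger F γ b₀ p₀ hJK ρ U, log_sub_log_eq_ledger F γ b₀ p₀ hJK ρ V,
    log_sub_log_eq_ledger F γ b₀ p₀ hJK ρ W, log_sub_log_eq_ledger F γ b₀ p₀ hJK ρ Z,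
    hc U hU, hc V hV', hc W hW, hc Z hZ]
  -- the version term cancels in the mixed difference; the increments are summed scale by scale
  have hsplit : ∀ (a sU sV sW sZ : ℝ), ((a + sU) - (a + sV)) - ((a + sW) - (a + sZ)) = (sU - sV) - (sW - sZ) := by
    intros; ring
  rw [hsplit, ← Finset.sum_sub_distrib, ← Finset.sum_sub_distrib, ← Finset.sum_sub_distrib]
  have hrefl := Finset.sum_range_reflect (fun r => w J r * Real.exp (-(κ * (b.src.tdist b'.src : ℝ)))) (K - J + 1)
  simp only [Nat.add_sub_cancel] at hrefl
  calc _ ≤ ∑ M ∈ Finset.range (K - J + 1),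
          |(((Real.log (heightDensityCan F γ hJK
                {Y : GaugeField (F.P K) 0 (Matrix.specialUnitaryGroup (Fin 2) ℂ) | ∀ j, j + J ≤ K → j < M → PlaqSmall (θBal F.L γ b₀ p₀ (K - j))
                  (Averaging.iter (fun i => BlockAveraging.blockAvg (P := F.P K) (j := i) ℰp) j Y)} U)
              - Real.log (heightDensityCan F γ hJK
                {Y : GaugeField (F.P K) 0 (Matrix.specialUnitaryGroup (Fin 2) ℂ) | ∀ j, j + J ≤ K → j < (M + 1) → PlaqSmall (θBal F.L γ b₀ p₀ (K - j))
                  (Averaging.iter (fun i => BlockAveraging.blockAvg (P := F.P K) (j := i) ℰp) j Y)} U)) - (Real.log (heightDensityCan F γ hJK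
                {Y : GaugeField (F.P K) 0 (Matrix.specialUnitaryGroup (Fin 2) ℂ) | ∀ j, j + J ≤ K → j < M → PlaqSmall (θBal F.L γ b₀ p₀ (K - j))
                  (Averaging.iter (fun i => BlockAveraging.blockAvg (P := F.P K) (j := i) ℰp) j Y)} V)
              - Real.log (heightDensityCan F γ hJK
                {Y : GaugeField (F.P K) 0 (Matrix.specialUnitaryGroup (Fin 2) ℂ) | ∀ j, j + J ≤ K → j < (M + 1) → PlaqSmall (θBal F.L γ b₀ p₀ (K - j))
                  (Averaging.iter (fun i => BlockAveraging.blockAvg (P := F.P K) (j := i) ℰp) j Y)} V)))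
            - ((Real.log (heightDensityCan F γ hJK
                {Y : GaugeField (F.P K) 0 (Matrix.specialUnitaryGroup (Fin 2) ℂ) | ∀ j, j + J ≤ K → j < M → PlaqSmall (θBal F.L γ b₀ p₀ (K - j))
                  (Averaging.iter (fun i => BlockAveraging.blockAvg (P := F.P K) (j := i) ℰp) j Y)} W)
              - Real.log (heightDensityCan F γ hJK
                {Y : GaugeField (F.P K) 0 (Matrix.specialUnitaryGroup (Fin 2) ℂ) | ∀ j, j + J ≤ K → j < (M + 1) → PlaqSmall (θBal F.L γ b₀ p₀ (K - j))
                  (Averaging.iter (fun i => BlockAveraging.blockAvg (P := F.P K) (j := i) ℰp) j Y)} W)) - (Real.log (heightDensityCan F γ hJK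
                {Y : GaugeField (F.P K) 0 (Matrix.specialUnitaryGroup (Fin 2) ℂ) | ∀ j, j + J ≤ K → j < M → PlaqSmall (θBal F.L γ b₀ p₀ (K - j))
                  (Averaging.iter (fun i => BlockAveraging.blockAvg (P := F.P K) (j := i) ℰp) j Y)} Z)
              - Real.log (heightDensityCan F γ hJK
                {Y : GaugeField (F.P K) 0 (Matrix.specialUnitaryGroup (Fin 2) ℂ) | ∀ j, j + J ≤ K → j < (M + 1) → PlaqSmall (θBal F.L γ b₀ p₀ (K - j))
                  (Averaging.iter (fun i => BlockAveraging.blockAvg (P := F.P K) (j := i) ℰp) j Y)} Z))))| := Finset.abs_sum_le_sum_abs _ _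
    _ ≤ ∑ M ∈ Finset.range (K - J + 1), w J (K - J - M) * Real.exp (-(κ * (b.src.tdist b'.src : ℝ))) := by
        refine Finset.sum_le_sum fun M hM => ?_
        have hMK : M + J ≤ K := by
          have := Finset.mem_range.mp hM
          omega
        exact hL J K hJK hposM M hMK b b' U V W Z hU hV' hW hZ h1 h2 h3 h4
    _ = ∑ r ∈ Finset.range (K - J + 1), w J r * Real.exp (-(κ * (b.src.tdist b'.src : ℝ))) := hrefl
    _ = (∑ r ∈ Finset.range (K - J + 1), w J r) * Real.exp (-(κ * (b.src.tdist b'.src : ℝ))) := by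
        rw [Finset.sum_mul]
    _ ≤ ψ J * Real.exp (-(κ * (b.src.tdist b'.src : ℝ))) :=
        mul_le_mul_of_nonneg_right (hwψ J (K - J + 1)) (Real.exp_nonneg _)


/-! ## §3 (v1.1 APPEND) LFR♯ᶜ ⟸ PREG′ ∧ LEV — the positivity row in the WINDOW-VERSION context (px16 g12's PREG′ ∕ ★★OWNER WORD 62) -/

/-- ★★★ **LFR♯ᶜ ⟸ PREG′ ∧ LEV**: as `largeFieldFourPtCan_of_partialWindowPositivity_of_levelOddsLedger`, but the positivity row is asked only INSIDE LFR♯ᶜ's own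
`(ν, ρ)`-context — PREG′ := PREG's text with VERS's prefix `(ν)(hνK)(hνd)(J K hJK)(ρ)(hρ)(hνρ)(hρc)` inserted (the conclusion shape of px16 g12's
`…OddsLedgerPregEnds.partialWindowPositivity_of_interiorRegSet`, whose only hypothesis is the interior-depth regularity row PWREG-int; on the first rung
`K = J + 1` PREG′ holds outright by `…partialWindowPositivity_depthOne`).  Same proof: the row is consumed after `ν, ρ` are fixed. [cite: Balaban1985UV3, (38)-(47) p.266-267] -/
theorem largeFieldFourPtCan_of_partialWindowPositivity'_of_levelOddsLedger
    (hP :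
    ∀ (L : ℕ), ∃ pS : ℝ, ∀ (b₀ p₀ : ℝ), 0 < b₀ → pS ≤ p₀ → 0 < p₀ →
      ∃ γ₁ : ℝ, 0 < γ₁ ∧ ∀ (F : T3Family) (γ : ℝ), F.L = L → 0 < γ → γ ≤ γ₁ →
        ∀ (ν : ℕ → (j : ℕ) → Measure (GaugeField (F.P j) 0 (Matrix.specialUnitaryGroup (Fin 2) ℂ))),
          (∀ K, ν K K = T4GenFunBounds.gibbsMeasure (F.P K) ((F.scheme ℰp γ).β K)) →
          (∀ K j, j < K → ν K j = Measure.map (descend F ℰp j) (ν K (j + 1))) →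
          ∀ (J K : ℕ) (hJK : J ≤ K) (ρ : GaugeField (F.P J) 0 (Matrix.specialUnitaryGroup (Fin 2) ℂ) → ℝ),
            (∀ U, PlaqSmall (θBal F.L γ b₀ p₀ J) U → 0 < ρ U) →
            ν K J = (fieldMeasure _ _ _).withDensity (fun U => ENNReal.ofReal (ρ U)) →
            ContinuousOn ρ {U | PlaqSmall (θBal F.L γ b₀ p₀ J) U} →
            (∀ U : GaugeField (F.P J) 0 (Matrix.specialUnitaryGroup (Fin 2) ℂ), PlaqSmall (θBal F.L γ b₀ p₀ J) U →
                0 < heightDensityCan F γ hJK (histGood F ℰp (θBal F.L γ b₀ p₀) K J) U) →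
            ∀ (M : ℕ) (U : GaugeField (F.P J) 0 (Matrix.specialUnitaryGroup (Fin 2) ℂ)), PlaqSmall (θBal F.L γ b₀ p₀ J) U →
              0 < heightDensityCan F γ hJK
                {Y : GaugeField (F.P K) 0 (Matrix.specialUnitaryGroup (Fin 2) ℂ) | ∀ j, j + J ≤ K → j < M → PlaqSmall (θBal F.L γ b₀ p₀ (K - j))
                  (Averaging.iter (fun i => BlockAveraging.blockAvg (P := F.P K) (j := i) ℰp) j Y)} U)
    (hL :
    ∀ (L : ℕ), ∃ pS : ℝ, ∀ (b₀ p₀ : ℝ), 0 < b₀ → pS ≤ p₀ → 0 < p₀ →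
      ∃ γ₁ : ℝ, 0 < γ₁ ∧ ∃ κ : ℝ, 0 < κ ∧ ∀ (F : T3Family) (γ : ℝ), F.L = L → 0 < γ → γ ≤ γ₁ →
        ∃ w : ℕ → ℕ → ℝ, (∀ J r, 0 ≤ w J r) ∧
          ∃ ψ : ℕ → ℝ, (∀ J, 0 ≤ ψ J) ∧ Tendsto (fun J : ℕ => (J : ℝ) * ψ J) atTop (𝓝 0) ∧
            (∀ J R, ∑ r ∈ Finset.range R, w J r ≤ ψ J) ∧
            ∀ (J K : ℕ) (hJK : J ≤ K),
              (∀ (M : ℕ) (U : GaugeField (F.P J) 0 (Matrix.specialUnitaryGroup (Fin 2) ℂ)), PlaqSmall (θBal F.L γ b₀ p₀ J) U →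
                  0 < heightDensityCan F γ hJK
                {Y : GaugeField (F.P K) 0 (Matrix.specialUnitaryGroup (Fin 2) ℂ) | ∀ j, j + J ≤ K → j < M → PlaqSmall (θBal F.L γ b₀ p₀ (K - j))
                  (Averaging.iter (fun i => BlockAveraging.blockAvg (P := F.P K) (j := i) ℰp) j Y)} U) →
              ∀ (M : ℕ), M + J ≤ K →
              ∀ (b b' : PBond (F.P J) 0) (U V W Z : GaugeField (F.P J) 0 (Matrix.specialUnitaryGroup (Fin 2) ℂ)),
                PlaqSmall (θBal F.L γ b₀ p₀ J) U → PlaqSmall (θBal F.L γ b₀ p₀ J) V →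
                PlaqSmall (θBal F.L γ b₀ p₀ J) W → PlaqSmall (θBal F.L γ b₀ p₀ J) Z →
                (∀ e, e ≠ b → U e = V e) → (∀ e, e ≠ b' → U e = W e) → (∀ e, e ≠ b' → V e = Z e) → (∀ e, e ≠ b → W e = Z e) →
                |(((Real.log (heightDensityCan F γ hJK
                {Y : GaugeField (F.P K) 0 (Matrix.specialUnitaryGroup (Fin 2) ℂ) | ∀ j, j + J ≤ K → j < M → PlaqSmall (θBal F.L γ b₀ p₀ (K - j))
                  (Averaging.iter (fun i => BlockAveraging.blockAvg (P := F.P K) (j := i) ℰp) j Y)} U)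
              - Real.log (heightDensityCan F γ hJK
                {Y : GaugeField (F.P K) 0 (Matrix.specialUnitaryGroup (Fin 2) ℂ) | ∀ j, j + J ≤ K → j < (M + 1) → PlaqSmall (θBal F.L γ b₀ p₀ (K - j))
                  (Averaging.iter (fun i => BlockAveraging.blockAvg (P := F.P K) (j := i) ℰp) j Y)} U)) - (Real.log (heightDensityCan F γ hJK
                {Y : GaugeField (F.P K) 0 (Matrix.specialUnitaryGroup (Fin 2) ℂ) | ∀ j, j + J ≤ K → j < M → PlaqSmall (θBal F.L γ b₀ p₀ (K - j))
                  (Averaging.iter (fun i => BlockAveraging.blockAvg (P := F.P K) (j := i) ℰp) j Y)} V)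
              - Real.log (heightDensityCan F γ hJK
                {Y : GaugeField (F.P K) 0 (Matrix.specialUnitaryGroup (Fin 2) ℂ) | ∀ j, j + J ≤ K → j < (M + 1) → PlaqSmall (θBal F.L γ b₀ p₀ (K - j))
                  (Averaging.iter (fun i => BlockAveraging.blockAvg (P := F.P K) (j := i) ℰp) j Y)} V)))
            - ((Real.log (heightDensityCan F γ hJK
                {Y : GaugeField (F.P K) 0 (Matrix.specialUnitaryGroup (Fin 2) ℂ) | ∀ j, j + J ≤ K → j < M → PlaqSmall (θBal F.L γ b₀ p₀ (K - j))
                  (Averaging.iter (fun i => BlockAveraging.blockAvg (P := F.P K) (j := i) ℰp) j Y)} W)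
              - Real.log (heightDensityCan F γ hJK
                {Y : GaugeField (F.P K) 0 (Matrix.specialUnitaryGroup (Fin 2) ℂ) | ∀ j, j + J ≤ K → j < (M + 1) → PlaqSmall (θBal F.L γ b₀ p₀ (K - j))
                  (Averaging.iter (fun i => BlockAveraging.blockAvg (P := F.P K) (j := i) ℰp) j Y)} W)) - (Real.log (heightDensityCan F γ hJK
                {Y : GaugeField (F.P K) 0 (Matrix.specialUnitaryGroup (Fin 2) ℂ) | ∀ j, j + J ≤ K → j < M → PlaqSmall (θBal F.L γ b₀ p₀ (K - j))
                  (Averaging.iter (fun i => BlockAveraging.blockAvg (P := F.P K) (j := i) ℰp) j Y)} Z)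
              - Real.log (heightDensityCan F γ hJK
                {Y : GaugeField (F.P K) 0 (Matrix.specialUnitaryGroup (Fin 2) ℂ) | ∀ j, j + J ≤ K → j < (M + 1) → PlaqSmall (θBal F.L γ b₀ p₀ (K - j))
                  (Averaging.iter (fun i => BlockAveraging.blockAvg (P := F.P K) (j := i) ℰp) j Y)} Z))))| ≤ w J (K - J - M) * Real.exp (-(κ * (b.src.tdist b'.src : ℝ)))) :
    ∀ (L : ℕ), ∃ pS : ℝ, ∀ (b₀ p₀ : ℝ), 0 < b₀ → pS ≤ p₀ → 0 < p₀ →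
      ∃ γ₁ : ℝ, 0 < γ₁ ∧ ∃ κ : ℝ, 0 < κ ∧ ∀ (F : T3Family) (γ : ℝ), F.L = L → 0 < γ → γ ≤ γ₁ →
        ∃ ψ : ℕ → ℝ, (∀ J, 0 ≤ ψ J) ∧ Tendsto (fun J : ℕ => (J : ℝ) * ψ J) atTop (𝓝 0) ∧
          ∀ (ν : ℕ → (j : ℕ) → Measure (GaugeField (F.P j) 0 (Matrix.specialUnitaryGroup (Fin 2) ℂ))),
            (∀ K, ν K K = T4GenFunBounds.gibbsMeasure (F.P K) ((F.scheme ℰp γ).β K)) →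
            (∀ K j, j < K → ν K j = Measure.map (descend F ℰp j) (ν K (j + 1))) →
            ∀ (J K : ℕ) (hJK : J ≤ K) (ρ : GaugeField (F.P J) 0 (Matrix.specialUnitaryGroup (Fin 2) ℂ) → ℝ),
              (∀ U, PlaqSmall (θBal F.L γ b₀ p₀ J) U → 0 < ρ U) →
              ν K J = (fieldMeasure _ _ _).withDensity (fun U => ENNReal.ofReal (ρ U)) →
              ContinuousOn ρ {U | PlaqSmall (θBal F.L γ b₀ p₀ J) U} →
              (∀ U : GaugeField (F.P J) 0 (Matrix.specialUnitaryGroup (Fin 2) ℂ), PlaqSmall (θBal F.L γ b₀ p₀ J) U →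
                  0 < heightDensityCan F γ hJK (histGood F ℰp (θBal F.L γ b₀ p₀) K J) U) →
              ∀ (b b' : PBond (F.P J) 0) (U V W Z : GaugeField (F.P J) 0 (Matrix.specialUnitaryGroup (Fin 2) ℂ)),
                PlaqSmall (θBal F.L γ b₀ p₀ J) U → PlaqSmall (θBal F.L γ b₀ p₀ J) V →
                PlaqSmall (θBal F.L γ b₀ p₀ J) W → PlaqSmall (θBal F.L γ b₀ p₀ J) Z →
                (∀ e, e ≠ b → U e = V e) → (∀ e, e ≠ b' → U e = W e) → (∀ e, e ≠ b' → V e = Z e) → (∀ e, e ≠ b → W e = Z e) →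
                |(((Real.log (ρ U) - Real.log (heightDensityCan F γ hJK (histGood F ℰp (θBal F.L γ b₀ p₀) K J) U)) - (Real.log (ρ V) - Real.log (heightDensityCan F γ hJK (histGood F ℰp (θBal F.L γ b₀ p₀) K J) V)))
            - ((Real.log (ρ W) - Real.log (heightDensityCan F γ hJK (histGood F ℰp (θBal F.L γ b₀ p₀) K J) W)) - (Real.log (ρ Z) - Real.log (heightDensityCan F γ hJK (histGood F ℰp (θBal F.L γ b₀ p₀) K J) Z))))|
                  ≤ ψ J * Real.exp (-(κ * (b.src.tdist b'.src : ℝ))) := by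
  intro L
  obtain ⟨pP, hP⟩ := hP L
  obtain ⟨pL, hL⟩ := hL L
  refine ⟨max pP pL, fun b₀ p₀ hb₀ hp hp₀ => ?_⟩
  obtain ⟨γP, hγP, hP⟩ := hP b₀ p₀ hb₀ ((le_max_left _ _).trans hp) hp₀
  obtain ⟨γL, hγL, κ, hκ, hL⟩ := hL b₀ p₀ hb₀ ((le_max_right _ _).trans hp) hp₀
  refine ⟨min γP γL, lt_min hγP hγL, κ, hκ, fun F γ hFL hγ hγ₁ => ?_⟩
  obtain ⟨w, hw0, ψ, hψ0, hψt, hwψ, hL⟩ := hL F γ hFL hγ (hγ₁.trans (min_le_right _ _))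
  have hP' := hP F γ hFL hγ (hγ₁.trans (min_le_left _ _))
  refine ⟨ψ, hψ0, hψt, ?_⟩
  intro ν hνK hνd J K hJK ρ hρ hνρ hρc hpos b b' U V W Z hU hV' hW hZ h1 h2 h3 h4
  obtain ⟨c, hc⟩ := fullVersionConstCan F γ b₀ p₀ hγ ν hνK hνd J K hJK ρ hρ hνρ hρc
  have hposM := hP' ν hνK hνd J K hJK ρ hρ hνρ hρc hpos
  rw [log_sub_log_eq_ledger F γ b₀ p₀ hJK ρ U, log_sub_log_eq_ledger F γ b₀ p₀ hJK ρ V,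
    log_sub_log_eq_ledger F γ b₀ p₀ hJK ρ W, log_sub_log_eq_ledger F γ b₀ p₀ hJK ρ Z,
    hc U hU, hc V hV', hc W hW, hc Z hZ]
  have hsplit : ∀ (a sU sV sW sZ : ℝ), ((a + sU) - (a + sV)) - ((a + sW) - (a + sZ)) = (sU - sV) - (sW - sZ) := by
    intros; ring
  rw [hsplit, ← Finset.sum_sub_distrib, ← Finset.sum_sub_distrib, ← Finset.sum_sub_distrib]
  have hrefl := Finset.sum_range_reflect (fun r => w J r * Real.exp (-(κ * (b.src.tdist b'.src : ℝ)))) (K - J + 1)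
  simp only [Nat.add_sub_cancel] at hrefl
  calc _ ≤ ∑ M ∈ Finset.range (K - J + 1),
          |(((Real.log (heightDensityCan F γ hJK
                {Y : GaugeField (F.P K) 0 (Matrix.specialUnitaryGroup (Fin 2) ℂ) | ∀ j, j + J ≤ K → j < M → PlaqSmall (θBal F.L γ b₀ p₀ (K - j))
                  (Averaging.iter (fun i => BlockAveraging.blockAvg (P := F.P K) (j := i) ℰp) j Y)} U)
              - Real.log (heightDensityCan F γ hJK
                {Y : GaugeField (F.P K) 0 (Matrix.specialUnitaryGroup (Fin 2) ℂ) | ∀ j, j + J ≤ K → j < (M + 1) → PlaqSmall (θBal F.L γ b₀ p₀ (K - j))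
                  (Averaging.iter (fun i => BlockAveraging.blockAvg (P := F.P K) (j := i) ℰp) j Y)} U)) - (Real.log (heightDensityCan F γ hJK
                {Y : GaugeField (F.P K) 0 (Matrix.specialUnitaryGroup (Fin 2) ℂ) | ∀ j, j + J ≤ K → j < M → PlaqSmall (θBal F.L γ b₀ p₀ (K - j))
                  (Averaging.iter (fun i => BlockAveraging.blockAvg (P := F.P K) (j := i) ℰp) j Y)} V)
              - Real.log (heightDensityCan F γ hJK
                {Y : GaugeField (F.P K) 0 (Matrix.specialUnitaryGroup (Fin 2) ℂ) | ∀ j, j + J ≤ K → j < (M + 1) → PlaqSmall (θBal F.L γ b₀ p₀ (K - j))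
                  (Averaging.iter (fun i => BlockAveraging.blockAvg (P := F.P K) (j := i) ℰp) j Y)} V)))
            - ((Real.log (heightDensityCan F γ hJK
                {Y : GaugeField (F.P K) 0 (Matrix.specialUnitaryGroup (Fin 2) ℂ) | ∀ j, j + J ≤ K → j < M → PlaqSmall (θBal F.L γ b₀ p₀ (K - j))
                  (Averaging.iter (fun i => BlockAveraging.blockAvg (P := F.P K) (j := i) ℰp) j Y)} W)
              - Real.log (heightDensityCan F γ hJK
                {Y : GaugeField (F.P K) 0 (Matrix.specialUnitaryGroup (Fin 2) ℂ) | ∀ j, j + J ≤ K → j < (M + 1) → PlaqSmall (θBal F.L γ b₀ p₀ (K - j))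
                  (Averaging.iter (fun i => BlockAveraging.blockAvg (P := F.P K) (j := i) ℰp) j Y)} W)) - (Real.log (heightDensityCan F γ hJK
                {Y : GaugeField (F.P K) 0 (Matrix.specialUnitaryGroup (Fin 2) ℂ) | ∀ j, j + J ≤ K → j < M → PlaqSmall (θBal F.L γ b₀ p₀ (K - j))
                  (Averaging.iter (fun i => BlockAveraging.blockAvg (P := F.P K) (j := i) ℰp) j Y)} Z)
              - Real.log (heightDensityCan F γ hJK
                {Y : GaugeField (F.P K) 0 (Matrix.specialUnitaryGroup (Fin 2) ℂ) | ∀ j, j + J ≤ K → j < (M + 1) → PlaqSmall (θBal F.L γ b₀ p₀ (K - j))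
                  (Averaging.iter (fun i => BlockAveraging.blockAvg (P := F.P K) (j := i) ℰp) j Y)} Z))))| := Finset.abs_sum_le_sum_abs _ _
    _ ≤ ∑ M ∈ Finset.range (K - J + 1), w J (K - J - M) * Real.exp (-(κ * (b.src.tdist b'.src : ℝ))) := by
        refine Finset.sum_le_sum fun M hM => ?_
        have hMK : M + J ≤ K := by
          have := Finset.mem_range.mp hM
          omega
        exact hL J K hJK hposM M hMK b b' U V W Z hU hV' hW hZ h1 h2 h3 h4
    _ = ∑ r ∈ Finset.range (K - J + 1), w J r * Real.exp (-(κ * (b.src.tdist b'.src : ℝ))) := hrefl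
    _ = (∑ r ∈ Finset.range (K - J + 1), w J r) * Real.exp (-(κ * (b.src.tdist b'.src : ℝ))) := by
        rw [Finset.sum_mul]
    _ ≤ ψ J * Real.exp (-(κ * (b.src.tdist b'.src : ℝ))) :=
        mul_le_mul_of_nonneg_right (hwψ J (K - J + 1)) (Real.exp_nonneg _)

end Summit.QuantumFields.YangMills.Theorems.FluctuationComparisonRegPrIntLOddsLedgerReduction

end
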